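import Summits.BirchSwinnertonDyer.Rank1Residual.F1Sign2.LocalTowerSignLawAtTwo
import Literature.NumberTheory.EllipticCurves.LangHeightNonarchEstimate
import Literature.NumberTheory.EllipticCurves.QuadraticTwist
import HarnessLib

/-!
# Cell `bsd-f1-sign2`, DESC-§23♯: THE INTRINSIC DEEP-TWIST NÉRON LAWS AT `2` — any number field `K`, `v ∣ 2`, `e(v|2)` even (-desc g15, MEMO-desc §23-add2, §23-add3; CANDIDATES-delta DESC v23.3–v23.8)

TYPER FILING (cell `bsd-f1-sign2`, seat `-ty` g10; CANDIDATES.md rows DESC-§23♯ F♯, TY♯, TR♯, UC + carriers; -desc g15 filing ask 14:35:38Z (5)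
«the intrinsic sibling of `F1Sign2/DeepTwistLawsAtTwo.lean` (p640583) = body of `MEMO-desc-data/g15/lean/SketchG15Intrinsic.lean` 1af3bbfb5eb8a53f after
REF1 (D-desc-44 = D-ty-ref1-31)»; farm rc 0 · 0 · 0 · 0; BC7 4/4 CLEAN 64a858eb43b2e91d): the sketch body VERBATIM — same flat namespace
`…Rank1Residual.F1Sign2` (next to `LocalTowerSignLawAtTwo`, `DeepTwistLawsAtTwo`), same imports (`F1Sign2.LocalTowerSignLawAtTwo`,
`Literature.…LangHeightNonarchEstimate` for `kodairaSymbolAt`, `tamagawaNumberAt`, `conductorExponent` over number fields, `Literature.…QuadraticTwist`).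
Decls: carriers `ordAt` (`ord_v`: Mathlib's multiplicative valuation read additively, junk `0` at `0`), `ramificationIdxOverTwo` (`e(v|2)` =
`Ideal.ramificationIdx` over `ℤ`), `twoTorsionRootCountAt` (`#E(K_v)[2] − 1`); rows `IntrinsicDeepTwistConductorLawAtTwo` (F♯, support, KNOWN-type:
plain `def`), `IntrinsicDeepTwistNeronTypeLawAtTwo` (TY♯, `@[conjecture]`), `IntrinsicDeepTwistTamagawaRatioLawAtTwo` (TR♯ — the `±` object at `2`
read as the uniformiser-independence of a sign; `@[conjecture]`), `UnitChartDeepTwistLemmaAtTwo` (UC, KNOWN = Tate's algorithm Steps 1–6: plain `def`,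
FIRST PROVER TARGET), and the sketch's kernel-checked model `example` (the twist of the `2`-torsion chart; REF1 §117 r1: «keep it — it is the
BC5-style sanity anchor of (UC)»).  Typer edits = this header, the two `@[conjecture]` attributes and the REF1, REF2 sentences in the docstrings;
statements verbatim (REF1 r2: no `[E.IsElliptic]` binder added to (UC)).  Nothing is asserted: `def … : Prop` only.
Census = BC5 WITNESS: -desc kit j310143 (tag `bsd-frontier-data`; PARI `elllocalred` over `nfinit`; 60 032 random curves DEFINED over `ℚ(√2)`, `ℚ(i)`,
`ℚ(√−2)` (`e = 2`), `ℚ[y]/(y⁴+4y²+2)`, `ℚ(ζ₃₂)⁺` (`e = 4`); seven (field, uniformiser) pairs; 84 530 twist rows, 0 errors; raw output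
`tw5-all-j310143.out` 7b8961ed9262f102 under `HOME/MEMO-desc-data/g15/`): (F♯) 74 030/74 030 (+ 0/10 500 at the excluded tie `f = 4e + 2`);
(TY♯) (a) 7 743/7 743 · (b) 16 440/16 440 · (c) 7 361/7 361; (TR♯) 3 389/3 389 (3 380 + 9 rows with `j = 0`); (UC) 503/503; second reading =
REF1 §117 independent literal replay (`recount117.py`), 0 exceptions anywhere; the base-change case is §23 (TY) of the sibling file (9 930 cells,
two engines: REF2 v28 table × kit j309612).
REF1-AUDIT §117 (refuter-bsd-f1-sign2-ref1 g10, 2026-08-28T14:48:15Z; evidence `HOME/REF1-data/b117/` — Probe117 3383fc9425ca576b rc 0 · 0 · 0 · 0,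
`recount117`, `chart117`, `mutate117`; gate D-ty-ref1-31 CLEARED: port 1af3bbfb5eb8a53f VERBATIM): «intrinsic deep-twist rows — ALL FOUR SURVIVE,
KILLED none. (F♯) THEOREM-GRADE (KNOWN; = §113 (F) made intrinsic: all upper breaks of σ_E are < 2e when f_v(E) ≤ 4e+1, a(η_δ) = 2e+1 for a
uniformiser δ, hence sw(σ_E ⊗ η_δ) = 2·2e, f = 4e+2). (UC) THEOREM-GRADE IN SUBSTANCE — Tate Steps 1–6 certified line by line for EVERY e ≥ 1 and
every residue field (e5 kernel: b₂ = 4aπ, b₄ = 2bπ², b₆ = 0, b₈ = −b²π⁴, Δ_T = 16π⁶b²(a²−4b); P(t) = t(t²+āt+b̄) separable ⟹ I₀*, f = 4e+2,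
c = 2 + #k-roots of the quadratic = #E₁(K_v)[2] by Hensel + e4b). (TY♯) clause (b) THEOREM-GRADE IN SUBSTANCE on unit and one-unit REDUCED charts
with f_v(E) ≤ 4e+1 (UC + T2Φ(i) + rider 5 `m = 2v(b) + v(a²−4b) = 8e − v(j)`; e6 kernel: c₄(E₁) = 16(a²−3b), Δ(E₁) = 16b²(a²−4b), so `max(0,·)`
is exactly right; every deep curve of the census has such a chart: 0 both-in-𝔭 reduced charts among 4 705); clause (c) THEOREM-GRADE IN SUBSTANCE on
the unit chart and, on one-unit charts, in the square and unramified discriminant classes (T2Φ (iii)–(v)); clause (a) and clause (c) on the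
ramified classes `Δ_E ∈ {−1,−2,−5,−10}·K_v^{×2}` remain conjecture-grade (owner -imc S3, D-imc-37). (TR♯) SURVIVES conjecture-grade (literal replay
3 389/3 389; theorem in words on the square class and on the unramified class; the sign ε = (c − 3)·(Δ_E, δ)_v is +1 on 13 257 rows and −1 on
361 rows — NOT a universal constant; (TR♯) only asserts constancy in δ per curve, correctly). Riders 5 and 6 (component criterion `c = 4 ⟺ ∃ ξ
unit, ξ(ξ²+aξ+b) ∈ πK^{×2}`, worked instance 8 + 6√2 = √2·(√2(1+√2))²) CORRECT AS PRINTED. A1: carriers read correctly — `ordAt v 0 = 0` junk ⟹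
`0 ≤ ord j` and `ord j < 8e` ADMIT j = 0, consistently with the `if E.j = 0` clause; e3 (kernel): 2 ∈ v ⟹ `v.asIdeal.under ℤ = (2)`, so
`ramificationIdxOverTwo v` IS e(v|2); `Even (ramificationIdxOverTwo v)` excludes every e-odd completion (justified: §116 n = 1 failures 2 896/4 432;
-imc §10.79 class (4,6,11) deviates exactly at odd e); `(8e + ordAt v E.Δ) % 12` uses the MODEL discriminant — harmless. Mutation: `3 ≤ f → 2 ≤ f`
and dropping `0 ≤ ord j` cost nothing; the window widens to `f ≤ 2e+2` with 0 failures in all four clauses (10 021, 28 539, 8 615, 6 464); the first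
(b)-failures sit exactly at f = 2e+3 = the both-in-𝔭 threshold of conjecture (CH) «both-in-𝔭 reduced 2-torsion chart ⟹ f_v(E₁) ≥ 2e+3» (r3: one
kit job at e = 6, 8; r4: keep the narrow rows — they carry the words-proofs — and add wide siblings append-only if typed). REF2 placement unchanged.»
Typer uptake: r1 — tags as audited: (F♯) plain support `def` (KNOWN), (UC) plain `def` (prover target), (TY♯) and (TR♯) `@[conjecture]` (attribute
only); `example` kept; r2 — no instance binder added; r3, r4, r6 are -desc and -data calls (no statement in this file changes; wide rows, if typed, go
under NEW names append-only); r5 noted on (TR♯).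
REF2-PLACEMENT v31 §2 + add-1 (refuter-bsd-f1-sign2-ref2 g31, 14:22:26Z) and v32 §2.1 (g32, 14:47:56Z; `HOME/REF2-PLACEMENT-v31.md`, `-v32.md`):
«(F♯) KNOWN — Serre, Corps locaux IV §3 (Herbrand, upper numbering on quotients) + VI §2 (Artin conductor via the upper filtration), Katz GKM (1988)
Lemma 1.3, Def. 1.6 (break(η_δ) = 2e_K exceeds breaks(σ_E) ≤ e_K) — file as plain support def, KNOWN-type, like (F); (TY♯) KNOWN on the
quadratic-semistable sub-family (Wang 2024 arXiv:2406.01985 Cor. 2.12, Thm 1.2 ← Lorenzini 2010 Thm 2.8, 2013 Thm 4.2: I*_{4s−v(j)} with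
s_{K(√δ)/K} = 2e_K; II, I₀*, II* by 2s+3 mod 6), VARIANT beyond (no table over ramified 2-adic K in print: Comalada 1994's residue-characteristic-2
rows are flagged erroneous by Barrios et al. 2025 p. 4; Barrios 2025 Thm 3 is K = ℚ₂ only) — conjecture-grade, NEW-COMBINATION-small at most; the
Tamagawa VALUE with ε(E) inserted is determined in print by Kramer–Tunnell 1982 Thm 7.6 + Dokchitser–Dokchitser 2011 Thm 5, 26, 35
(ε(E) = w(E/K)·w(E^δ/K)·(−1,δ)_K·(−1)^{ord₂ c(E/K)+ord₂ c(E/K(√δ))+D}; falsifier D-desc-46 owed, -desc g16); (TR♯) as typed (uniformiser-independence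
only, no ε carrier) is not in print as stated; (UC) KNOWN = Tate's algorithm Steps 1–6 (Silverman ATAEC IV.9.4; tabulated over any complete DVR of
residue characteristic 2 by Barrios et al. 2025, arXiv 2501.03209, Prop. 3.4 row I₀*): type I₀*, f = 4e+2, c = 1 + #k-roots of T(T² + āT + b̄)
= #E₁(K)[2]; T2Φ closed forms VARIANT (mechanism KNOWN-elementary, v32 §2.2); beyond-print no throughout; the open half of (TY♯)(c) = -imc's (R)
`LocalTowerSignLawAtTwoCondThreeMPosRam` = (S3): NOT IN PRINT (v32 §1.4; Dokchitser–Dokchitser 2015 Table 1 leaves the potentially-supersingular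
wild cell «?»).» [cite: SerreLocalFields1979, IV §3, VI §2] [cite: Katz1988, Ch. 1 Lemma 1.3, Def. 1.6] [cite: SilvermanATAEC1994, IV.9.4 Steps 1–7]
[cite: BarriosEtAl2025, Prop. 3.4] [cite: KramerTunnell1982, Thm. 7.6] [cite: DokchitserDokchitser2011, Thm. 5]
PARTITION: none moved (frontier tier); beyond-print theorem: no ((UC), T2Φ, riders 5 and 6 are textbook-method lemmas; (TY♯)(a), (TR♯) and the
ramified half of (TY♯)(c) are the conjectural content = the open cell of -imc's (R), S3).  BSD is not proved by any of this.
bears_on: F1Sign2 leaf (IMC-LTS `LocalTowerSignLawAtTwo` p636363 ⟸ (T_n) ⟸ (TY) of the sibling `DeepTwistLawsAtTwo.lean` p640583; f₂ = 3 rung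
`LocalTowerSignLawAtTwoCondThree.lean` p642130); asks D-desc-44 (REF1, answered §117), D-ty-ref1-31 (cleared), D-desc-46 (ε falsifier, -desc g16),
r3 (CH) kit job (-data).

## The sketch's own summary (verbatim)

# Cell `bsd-f1-sign2`, lens `-desc` g15 (MEMO-desc §23-add2): the INTRINSIC deep-twist Néron laws over an
arbitrary 2-adic field with even ramification index

Intrinsic (base-field) form of the §23 rows `DeepTwistConductorLawAtTwo` / `DeepTwistNeronTypeLawAtTwo`: the tower
`ℚ = ℚ_0 ⊂ ℚ_1 ⊂ …` and the curve `W/ℚ` are replaced by ANY number field `K`, a place `v ∣ 2` with EVEN `e(v|2)`, a curve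
`E/K` and a uniformiser `δ` at `v`; the twist is `E ⊗ η_δ = E.quadraticTwist δ`.  Census (kit j310143, PARI `elllocalred`
over `nf`, 60 032 random curves DEFINED over `ℚ(√2)`, `ℚ(i)`, `ℚ(√−2)`, `ℚ[y]/(y⁴+4y²+2)`, `ℚ(ζ₃₂)⁺`, seven (field,
uniformiser) pairs, 0 errors): conductor clause 74 030/74 030 rows (+ 10 500/10 500 failures at the excluded tie
`f = 4e + 2`); type clauses 24 183/24 183 rows in the deep range `3 ≤ f(E/K) ≤ e + 2` (odd `m` included); `I₀*`-Tamagawa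
clause 7 361/7 361; twist-ratio law (TR♯) 3 380/3 380.  NOT asserted (open): the VALUE of the Tamagawa number for type
`I*_m`, `m ≥ 1`, which over `K` is `3 + ε(E)·(Δ_E, δ)_v` with a curve-dependent sign `ε` (`= +1` on base changes from `ℚ₂`,
§23 (TY)); (TR♯) states exactly its `δ`-dependence.
Nothing is asserted: `def … : Prop` only.
-/

noncomputable section

open scoped Classical NumberField

open WeierstrassCurve Literature.NumberTheory.EllipticCurves Literature.NumberTheory.DiophantineGeometry IsDedekindDomain

namespace Summit.BirchSwinnertonDyer.Rank1Residual.F1Sign2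

variable {K : Type*} [Field K] [NumberField K]

/-- `ord_v(x) ∈ ℤ` for `x : K` (Mathlib convention `v(π) = exp(−1)`; junk `0` at `x = 0`). -/
def ordAt (v : HeightOneSpectrum (𝓞 K)) (x : K) : ℤ :=
  - WithZero.log (v.valuation K x)

/-- The absolute ramification index `e(v | p)` of `v` over the rational prime below it (`= e(v | 2)` under the
standing hypothesis `2 ∈ v`): the length of `(𝓞 K)_v / p(𝓞 K)_v` (Mathlib `Ideal.ramificationIdx`). -/
def ramificationIdxOverTwo (v : HeightOneSpectrum (𝓞 K)) : ℕ :=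
  v.asIdeal.ramificationIdx ℤ

/-- The number of `K_v`-rational `2`-torsion abscissae of `E`: roots in the completion `K_v` of the `2`-division
polynomial `4x³ + b₂x² + 2b₄x + b₆` (`= #E(K_v)[2] − 1 ∈ {0, 1, 3}` for elliptic `E`). -/
def twoTorsionRootCountAt (v : HeightOneSpectrum (𝓞 K)) (E : WeierstrassCurve K) : ℕ :=
  Set.ncard {x : v.adicCompletion K |
    (4 : v.adicCompletion K) * x ^ 3 + algebraMap K (v.adicCompletion K) E.b₂ * x ^ 2
      + 2 * algebraMap K (v.adicCompletion K) E.b₄ * x + algebraMap K (v.adicCompletion K) E.b₆ = 0}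

/-- **(F♯) Intrinsic deep-twist conductor law** (THEOREM-level: `sw(σ_E ⊗ η_δ) = 2·max(u(σ_E), 2e)` off the tie
`u(σ_E) = 2e`, i.e. `f(E) = 4e + 2`).  For `E/K` elliptic, `v ∣ 2`, `δ` a uniformiser at `v` and `f_v(E) ≤ 4e + 1`:
`f_v(E ⊗ η_δ) = 4e + 2 = 2·f(η_δ)`.  Census 74 030/74 030 (`2 ≤ f_v(E) ≤ 4e + 1`); at `f_v(E) = 4e + 2` it fails
(10 500/10 500 rows have `f′ ≤ 4e + 1`).
REF1 §117: THEOREM-GRADE (KNOWN; = §113 (F) made intrinsic; BC7: the bound `f ≤ 4e+1` is sharp, 0/10 500 at the tie).  REF2 v31 §2.1 + add-1: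
KNOWN — Serre, Corps locaux IV §3 + VI §2, Katz GKM Lemma 1.3, Def. 1.6 (break(η_δ) = 2e exceeds the breaks of σ_E); filed as a plain support `def`
(KNOWN-type, like (F) `DeepTwistConductorLawAtTwo`). [cite: SerreLocalFields1979, VI §2] [cite: Katz1988, Ch. 1 Lemma 1.3] -/
def IntrinsicDeepTwistConductorLawAtTwo : Prop :=
  ∀ (K : Type) [Field K] [NumberField K] (v : HeightOneSpectrum (𝓞 K)), (2 : 𝓞 K) ∈ v.asIdeal →
    ∀ (E : WeierstrassCurve K) [E.IsElliptic], E.conductorExponent v ≤ 4 * ramificationIdxOverTwo v + 1 →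
      ∀ δ : K, ordAt v δ = 1 →
        (E.quadraticTwist δ).conductorExponent v = 4 * ramificationIdxOverTwo v + 2

/-- **(TY♯) Intrinsic deep-twist Néron type law.**  `K` a number field, `v ∣ 2` with `e = e(v|2)` EVEN, `E/K` elliptic
with potentially good reduction at `v` (`ord_v j_E ≥ 0`) and `3 ≤ f_v(E) ≤ e + 2` (the DEEP range: the upper ramification
break of `σ_E` is `≤ e/2`), `δ ∈ K` with `ord_v δ = 1`, `T = E ⊗ η_δ`.  Then at `v`:
(a) if `E` has no `K_v`-rational `2`-torsion abscissa: `c_v(T) = 1` and type `I₀*` if `Δ_E ∈ K_v^{×2}`, else `II` when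
`8e + ord_v Δ_E ≡ 8 (mod 12)` and `II*` when `≡ 4 (mod 12)` (no other residue occurs: structural zero, 0/5 503 curves);
(b) if `E` has a `K_v`-rational `2`-torsion abscissa: type `I*_m`, `m = max(0, 8e − ord_v j_E)` (`j_E = 0` read as `m = 0`);
(c) whenever the type is `I₀*`: `c_v(T) = #E(K_v)[2]` (= `1 + #abscissae`).
Census (kit j310143; curves DEFINED over five fields with `e ∈ {2, 4}`, seven (field, uniformiser) pairs): (a) 7 743/7 743
rows, (b) 16 440/16 440 rows incl. 255 curves with odd `m`, (c) 7 361/7 361; base-change case = §23 (TY) (9 930 cells,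
two engines).  Why it might fail: a Kraus class over a field with `e ≥ 6` or `e ≡ 2 (mod 4), e ≥ 6` not sampled; the
Tamagawa number in case (b) with `m ≥ 1` is deliberately NOT asserted (it needs a further sign `ε(E)`).
REF1 §117: SURVIVES — clause (b) and, on the unit chart and on one-unit charts in the square or unramified classes, clause (c) THEOREM-GRADE IN
SUBSTANCE (UC + T2Φ + rider 5 `m = 2v(b) + v(a² − 4b) = 8e − v(j)`, certified); clause (a) and the ramified half of (c) conjecture-grade; tagged
`@[conjecture]` (r1, typer edit: attribute only).  r4: on j310143 the window `3 ≤ f ≤ e + 2` widens to `2 ≤ f ≤ 2e + 2` and `0 ≤ ord j` drops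
with 0 failures ((a) 10 021, (b) 28 539, (c) 8 615) — THIS is the narrow row (the one with words-proofs attached); a wide sibling, if -desc types
it, lands append-only under a new name.  REF2 v31 §2.2: KNOWN on the quadratic-semistable sub-family (Wang 2024 Cor. 2.12, Thm 1.2; Lorenzini 2010
Thm 2.8), VARIANT beyond; conjecture-grade, NEW-COMBINATION-small at most; beyond-print no.
LANDING NOTE (-ty g11, 2026-08-28; director's rule: first word «misstated»): misstated — the `IsSquare Δ_v → I₀*` conjunct of CLAUSE (a) of this row is
FALSE at places of EVEN residue degree (MEMO-desc §24.6, D-desc-57; REF2 v37 §1 AGREE refuted-MISSTATED; witness K = ℚ(√2,√−3), v ∣ 2 unique, e = 2,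
k_v = 𝔽₄, δ = 2+√2, E = W_K for each of 1 475 class-(a) W/ℚ with Δ_W ∈ −3ℚ₂^{×2}, 2 ≤ f₂ ≤ 6: every hypothesis holds, Δ ∈ K_v^{×2}, the row says I₀*,
truth = II/II*, smallest witness 88a1; at even residue degree `Δ_E ∈ K_v^{×2}` does not detect the unramified cubic).  REPAIRED STATEMENT (new name,
append-only; this decl stays as a negative edge): `IntrinsicDeepTwistNeronTypeLawAtTwoClassAOdd` (odd residue degree; window f ≤ 4e+1; no parity-of-e) in
`F1Sign2/NoTwoTorsionDeepTwistLawsAtTwo.lean`, derived by kernel glue from THEOREM Φ `NoTwoTorsionDeepTwistNeronLawAtTwo` (the residue trichotomy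
`ord_v Δ_E ≡ 4e / 4e−4 / 4e+4 (mod 12)`, any residue degree; REF1 §131).  Clauses (b), (c) and the rows (F♯)/(TR♯) are unaffected. -/
@[conjecture] def IntrinsicDeepTwistNeronTypeLawAtTwo : Prop :=
  ∀ (K : Type) [Field K] [NumberField K] (v : HeightOneSpectrum (𝓞 K)), (2 : 𝓞 K) ∈ v.asIdeal →
    Even (ramificationIdxOverTwo v) →
    ∀ (E : WeierstrassCurve K) [E.IsElliptic], 0 ≤ ordAt v E.j → 3 ≤ E.conductorExponent v →
      E.conductorExponent v ≤ ramificationIdxOverTwo v + 2 →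
      ∀ δ : K, ordAt v δ = 1 →
        (twoTorsionRootCountAt v E = 0 →
          (E.quadraticTwist δ).tamagawaNumberAt v = 1 ∧
          (IsSquare (algebraMap K (v.adicCompletion K) E.Δ) → (E.quadraticTwist δ).kodairaSymbolAt v = .Istar 0) ∧
          (¬ IsSquare (algebraMap K (v.adicCompletion K) E.Δ) →
            ((8 * (ramificationIdxOverTwo v : ℤ) + ordAt v E.Δ) % 12 = 8 → (E.quadraticTwist δ).kodairaSymbolAt v = .II) ∧
            ((8 * (ramificationIdxOverTwo v : ℤ) + ordAt v E.Δ) % 12 = 4 → (E.quadraticTwist δ).kodairaSymbolAt v = .IIstar))) ∧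
        (twoTorsionRootCountAt v E ≠ 0 →
          (E.quadraticTwist δ).kodairaSymbolAt v =
            .Istar (if E.j = 0 then 0 else (8 * (ramificationIdxOverTwo v : ℤ) - ordAt v E.j).toNat)) ∧
        ((E.quadraticTwist δ).kodairaSymbolAt v = .Istar 0 →
          (E.quadraticTwist δ).tamagawaNumberAt v = twoTorsionRootCountAt v E + 1)

/-- **(TR♯) Intrinsic twist-RATIO law for the Tamagawa number** (the `±` object at `2`, -desc g15 §23-add3).  In the setting
of (TY♯)(b) with `m ≥ 1` (`E` has a `K_v`-rational `2`-torsion abscissa and `ord_v j_E < 8e`), the twists of `E` by two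
uniformisers `δ₁, δ₂` (both of type `I*_m`, `c ∈ {2, 4}`) have the SAME Tamagawa number iff `δ₁δ₂` is a norm from
`K_v(√Δ_E)`, i.e. iff the Hilbert symbol `(Δ_E, δ₁δ₂)_v = +1`.  Equivalently `c_v(E ⊗ η_δ) = 3 + ε(E)·(Δ_E, δ)_v` for a sign
`ε(E)` that does NOT depend on the uniformiser (`ε = +1` on every base change from `ℚ₂` = §23 (TY)(b); `ε = −1` on the shelf
`ord_v j ≡ 4 (mod 8), m < 4e`; `ε = γ(E) := (c_v(E) − 3)` in the potentially ordinary case `ord_v j_E = 0`).  Census (kit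
j310143, the two fields sampled with two uniformisers: `ℚ(√2)` with `√2, 2+√2` and `ℚ(ζ₃₂)⁺` with `2+β₃, β₃`): 3 380/3 380
curves.  Why it might fail: only `e ∈ {2, 4}` and Galois-over-`ℚ` fields with two uniformiser classes tested.
REF1 §117: SURVIVES conjecture-grade, tagged `@[conjecture]` (r1); literal replay 3 389/3 389 (3 380 + 9 rows with `j = 0`, admitted by the junk
convention `ordAt v 0 = 0`); theorem in words on the square class and on the unramified class (`v(δ₁δ₂) = 2 ⟹ (Δ_E, δ₁δ₂)_v = +1`; `c` constant
`= 2` by T2Φ(iv)); r5: `ε = (c − 3)·(Δ_E, δ)_v` takes both signs on the census (13 257 : 361), so any typed VALUE law needs -imc's normaliser —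
this row asserts only constancy in `δ`.  REF2 v31 §2.3: ε(E) is KNOWN-determined (Kramer–Tunnell 1982 Thm 7.6 + Dokchitser–Dokchitser 2011 Thm 5;
falsifier D-desc-46 owed); the row as typed is not in print as stated. [cite: KramerTunnell1982, Thm. 7.6] [cite: DokchitserDokchitser2011, Thm. 5] -/
@[conjecture] def IntrinsicDeepTwistTamagawaRatioLawAtTwo : Prop :=
  ∀ (K : Type) [Field K] [NumberField K] (v : HeightOneSpectrum (𝓞 K)), (2 : 𝓞 K) ∈ v.asIdeal →
    Even (ramificationIdxOverTwo v) →
    ∀ (E : WeierstrassCurve K) [E.IsElliptic], 0 ≤ ordAt v E.j → ordAt v E.j < 8 * (ramificationIdxOverTwo v : ℤ) →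
      3 ≤ E.conductorExponent v → E.conductorExponent v ≤ ramificationIdxOverTwo v + 2 →
      twoTorsionRootCountAt v E ≠ 0 →
      ∀ δ₁ δ₂ : K, ordAt v δ₁ = 1 → ordAt v δ₂ = 1 →
        ((E.quadraticTwist δ₁).tamagawaNumberAt v = (E.quadraticTwist δ₂).tamagawaNumberAt v ↔
          ∃ x y : v.adicCompletion K,
            x ^ 2 - algebraMap K (v.adicCompletion K) E.Δ * y ^ 2 = algebraMap K (v.adicCompletion K) (δ₁ * δ₂))

/-- **(UC) Unit-chart lemma = the first rung of (TY♯)(b)+(c), PROVED IN WORDS (MEMO-desc §23-add3 rider 3; Tate's algorithm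
steps 1–6 + Hensel).**  `K` any number field, `v ∣ 2` (ANY ramification index, any residue field), `a, b ∈ 𝓞 K` both `v`-units,
`π ∈ K` with `ord_v π = 1`, `E₁ : y² = x(x² + ax + b)`.  The twist `E₁.quadraticTwist π` is literally the model
`y² = x(x² + aπx + bπ²)` (`b₂ = 4a`, `b₄ = 2b`, `b₆ = 0`); it is minimal of Kodaira type `I₀*` with `f_v = 4e + 2` and
`c_v = 1 + #{k-roots of t(t² + āt + b̄)} = #E₁(K_v)[2]`.  Why it might fail: it should not (textbook); filed as the BC5-style
witness / first prover target of the intrinsic rows.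
REF1 §117 rider 3: CERTIFIED line by line for EVERY `e ≥ 1` and every residue field (Tate Steps 1–6 with no change of coordinates; `f = v(Δ_T) − 4
= 4e + 2`; `c = 2 + #{k-roots of t² + āt + b̄} = twoTorsionRootCountAt v E₁ + 1` by Hensel) — THEOREM-GRADE IN SUBSTANCE, plain `def`, first prover
target (r2: no `[IsElliptic]` binder — non-singularity is forced, `Δ(E₁) = 16b²(a² − 4b)`).  REF2 v32 §2.1: «KNOWN = Tate's algorithm Steps 1–6
(Silverman ATAEC IV.9.4; tabulated over any complete DVR of residue characteristic 2 by Barrios et al. 2025, arXiv 2501.03209, Prop. 3.4 row I₀*):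
type I₀*, f = 4e+2, c = 1 + #k-roots of T(T² + āT + b̄) = #E₁(K)[2].»  beyond-print no. [cite: SilvermanATAEC1994, IV.9.4 Steps 1–6]
[cite: BarriosEtAl2025, Prop. 3.4] -/
def UnitChartDeepTwistLemmaAtTwo : Prop :=
  ∀ (K : Type) [Field K] [NumberField K] (v : HeightOneSpectrum (𝓞 K)), (2 : 𝓞 K) ∈ v.asIdeal →
    ∀ (a b : 𝓞 K), a ∉ v.asIdeal → b ∉ v.asIdeal → ∀ π : K, ordAt v π = 1 →
      ((⟨0, (a : K), 0, (b : K), 0⟩ : WeierstrassCurve K).quadraticTwist π).kodairaSymbolAt v = .Istar 0 ∧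
      ((⟨0, (a : K), 0, (b : K), 0⟩ : WeierstrassCurve K).quadraticTwist π).conductorExponent v
          = 4 * ramificationIdxOverTwo v + 2 ∧
      ((⟨0, (a : K), 0, (b : K), 0⟩ : WeierstrassCurve K).quadraticTwist π).tamagawaNumberAt v
          = twoTorsionRootCountAt v (⟨0, (a : K), 0, (b : K), 0⟩ : WeierstrassCurve K) + 1

/-- Sanity (characteristic `0`, where `quadraticTwist`'s divisions by `4` and `2` are harmless): the twist of the chart
`y² = x(x² + ax + b)` by `d` IS the model `y² = x(x² + adx + bd²)`. -/
example {F : Type*} [Field F] [CharZero F] (a b d : F) :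
    ((⟨0, a, 0, b, 0⟩ : WeierstrassCurve F).quadraticTwist d) = ⟨0, a * d, 0, b * d ^ 2, 0⟩ := by
  ext <;> simp [quadraticTwist, WeierstrassCurve.b₂, WeierstrassCurve.b₄, WeierstrassCurve.b₆] <;> field_simp

end Summit.BirchSwinnertonDyer.Rank1Residual.F1Sign2
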